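import Summits.ABC.IUTFork.Joshi.ThetaEvaluationLogShells
import HarnessLib

/-!
# [J-III] §9.7.4–9.7.5 à la Joshi: the global class `ξ_y ∈ H^1_e(arith(L′)_y, ℤ(1))` and the collation of Galois cohomology
# classes in a standard arithmeticoid (Proposition 9.7.5.1)

Block-E record file of the abc-iut cell (rung LADDER-ABC:A2.E; seat abc-iut-E-t21, slot T-21), sequel to
`ThetaEvaluationLogShells` (§9.5–9.7.3, the local carriers `LocalBKDatum` / `TateLocalDatum` and the class `ξ_w`). TYPES
K. Joshi, *Construction of Arithmetic Teichmüller Spaces III*, arXiv:2401.13508**v4** (UNREFEREED; bib `Joshi2024ATS3`;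
locators «p.N l.M» = PDF page N, line M of the cell's render), §9.7.4 (p.111 l.64–p.112 l.34: the global class assembled over
the Galois cohomology of an arithmeticoid, [ATS II½] arXiv:2305.10398 Def. 7.2.4 `H^1(arith(L)_y, ℤ(1)) := ∏_{v non}
H^1(G_{L_v};K_v, ℤ_{p_v}(1)) × ∏_{v arc} Ext^1(ℤ(0), ℤ(1))`) and §9.7.5 (p.112 l.35–71: Prop. 9.7.5.1, the set `Ψ_Σ` of all
translates of the classes into the STANDARD arithmeticoid `y₀` under the factorwise isomorphisms «provided by [ATS II½]
Prop. 7.4.1» — the construction [J-III] Thm.-Def. 9.8.1.1 (4)(5) feeds into `Θ̃_Joshi` / `Θ̃_Mochizuki`, E-t22's block).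
TAKES NO SIDE on [IUTchIII] Cor. 3.12, on Joshi's claims, or on Mochizuki's reports on them. Typed ≠ proved; typed AS A
CANDIDATE ≠ endorsed; nothing asserted. Carriers are parameters (instance-free): `V` places of `L′`, `K w = L′_w`, `H1 w` /
`H y w` the factor of the cohomology at `w`, `Y` holomorphoids. STRUCTURAL NOTE for the E3 dictionary (no test here):
`Ψ_Σ` is an ORBIT of a tuple of classes under a SET of factorwise isomorphisms — the same shape as the `⟨(Ind1) ∪ (Ind2)⟩`-
translates of `Summit.ABC.IUTFork.Cor312Vol.PilotKummerIndRelated`; which isomorphisms are admissible is a datum (field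
`ClassCollationDatum.iso`), print leaving open "all topological-group isomorphisms" vs "those induced by amphoricity". Reading
flag R1/R2 for Prop. 9.7.5.1 in the docstrings; Prop. 9.7.5.1 (existence of the set) is DISCHARGED by definition.
Standard axioms only; sorry-free.
-/

noncomputable section

namespace Summit.ABC.IUTFork.Joshi.ATS3

/-! ## 5. (9.7.4): the global class `ξ_y ∈ H^1_e(arith(L′)_y, ℤ(1))` -/

/-- The three kinds of places of `L′` in (9.7.4.2) ([J-III] p.112 l.1–34): archimedean (`w ∈ V^{arc}_{L′}`), odd semistable
(`w ∈ V^{odd,ss}`), and the remaining nonarchimedean places. [claim: Joshi2024ATS3, status: disputed] -/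
@[claim "Joshi2024ATS3" "disputed"]
inductive PlaceKind
  /-- `w ∈ V ∩ V^{arc}_{L′}` -/
  | arc
  /-- `w ∈ V^{odd,ss}` -/
  | oddss
  /-- `w ∈ V_{L′}` nonarchimedean, `w ∉ V^{odd,ss}` -/
  | other

/-- An odd semistable place is not archimedean (distinct constructors). [folklore] -/
theorem PlaceKind.ne_arc_of_eq_oddss {k : PlaceKind} (h : k = .oddss) : k ≠ .arc := by
  subst h; exact fun h' => PlaceKind.noConfusion h'

/-- A place of the third kind is not archimedean (distinct constructors). [folklore] -/
theorem PlaceKind.ne_arc_of_eq_other {k : PlaceKind} (h : k = .other) : k ≠ .arc := by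
  subst h; exact fun h' => PlaceKind.noConfusion h'

/-- **Arithmeticoid cohomology datum of a holomorphoid `y` of `X/L′`** (SIGNATURE for [J-III] 9.7.4, p.111 l.64–p.112 l.34, over
[ATS II½] arXiv:2305.10398 Def. 7.2.4: `H^1(arith(L)_y, ℤ(1)) := ∏_{v non} H^1(G_{L_v};K_v, ℤ_{p_v}(1)) × ∏_{v arc} Ext^1(ℤ(0), ℤ(1))`).
`V` = the places of `L′`; `K w` = `L′_w` (normed inside `K_w`); `H1 w` = the integral factor at `w` (`H^1(G_{L′_w};K_w, ℤ_{p_w}(1))`,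
resp. `Ext^1_{MHS}(ℤ(0), ℤ(1)) ≅ ℂ^×` at archimedean `w`, (9.1.2.1)); `H1Q w` = the rational factor. Fields: the kind of each
place, the local Bloch–Kato datum at every nonarchimedean place, `ℓ`, the root `q_w^{1/2ℓ}` at `w ∈ V^{odd,ss}` (odd `p_w`), and
the Schottky parameter class `q_w ∈ Ext^1_{MHS}(ℤ(0), ℤ(1))` at archimedean `w` (9.1.2, p.96 l.6–30; E-t19's block). «This
cohomology group depends on `arith(L′)_y`» (p.111 l.72–73): one such datum per holomorphoid `y`. [claim: Joshi2024ATS3, status: disputed] -/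
@[claim "Joshi2024ATS3" "disputed"]
structure ArithmeticoidDatum (V : Type*) (K H1 H1Q : V → Type*) [∀ w, NontriviallyNormedField (K w)] where
  /-- archimedean / odd semistable / other nonarchimedean -/
  kind : V → PlaceKind
  /-- the local Bloch–Kato datum at a nonarchimedean place -/
  bk : ∀ w, kind w ≠ .arc → LocalBKDatum (K w) (H1 w) (H1Q w)
  /-- the prime `ℓ` -/
  l : ℕ
  /-- `ℓ ≥ 1` -/
  one_le_l : 1 ≤ l
  /-- `w ∈ V^{odd,ss}` has odd residue characteristic -/
  p_ne_two : ∀ (w : V) (h : kind w = .oddss), (bk w (PlaceKind.ne_arc_of_eq_oddss h)).p ≠ 2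
  /-- the chosen root `q_w^{1/2ℓ} ∈ L′_w` at `w ∈ V^{odd,ss}` -/
  q2l : ∀ w, kind w = .oddss → K w
  /-- `q_w^{1/2ℓ} ≠ 0` -/
  q2l_ne_zero : ∀ w h, q2l w h ≠ 0
  /-- `|q_w^{1/2ℓ}| < 1` -/
  norm_q2l_lt_one : ∀ w h, ‖q2l w h‖ < 1
  /-- the Schottky parameter `q_w ∈ Ext^1_{MHS}(ℤ(0), ℤ(1))` at `w ∈ V ∩ V^{arc}_{L′}` -/
  qSchottky : ∀ w, kind w = .arc → H1 w

namespace ArithmeticoidDatum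

variable {V : Type*} {K H1 H1Q : V → Type*} [∀ w, NontriviallyNormedField (K w)] (A : ArithmeticoidDatum V K H1 H1Q)

/-- The local Tate datum at `w ∈ V^{odd,ss}` assembled from the global datum (9.6.1–9.6.2 at that `w`). DERIVED. [claim: Joshi2024ATS3, status: disputed] -/
@[claim "Joshi2024ATS3" "disputed"]
def tateAt (w : V) (h : A.kind w = .oddss) : TateLocalDatum (K w) (H1 w) (H1Q w) where
  toLocalBKDatum := A.bk w (PlaceKind.ne_arc_of_eq_oddss h)
  p_ne_two := A.p_ne_two w h
  l := A.l
  one_le_l := A.one_le_l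
  q2l := A.q2l w h
  q2l_ne_zero := A.q2l_ne_zero w h
  norm_q2l_lt_one := A.norm_q2l_lt_one w h

/-- The compatible system `1 + p*_w = {(1 + p*_w)^{1/p_w^n}}_{n ≥ 0}` as a class at a nonarchimedean `w` ((9.7.4.2) first case,
p.112 l.12–19; also [J-III] 9.8.1 p.113 l.55–66). DERIVED. [claim: Joshi2024ATS3, status: disputed] -/
@[claim "Joshi2024ATS3" "disputed"]
def onePStarClass (w : V) (h : A.kind w ≠ .arc) : H1 w := (A.bk w h).kummer (1 + (A.bk w h).pstar)

/-- The places `V_{L′,p}` over a rational prime `p` (the index set of 9.7.3). DERIVED. [claim: Joshi2024ATS3, status: disputed] -/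
@[claim "Joshi2024ATS3" "disputed"]
def placesOver (p : ℕ) : Set V := {w | ∃ h : A.kind w ≠ .arc, (A.bk w h).p = p}

/-- The local component `ξ_w` of (9.7.4.2) ([J-III] p.112 l.1–34) BY KIND: `ξ_w = {(1 + p*_w)^{1/p^n_w}}` if `w` is
nonarchimedean and `w ∉ V^{odd,ss}`; `= {(1 + p*_w·q_w^{1/2ℓ})^{1/p^n_w}}` if `w ∈ V^{odd,ss}`; `= q_w ∈ Ext^1_{MHS}(ℤ(0), ℤ(1))` if
`w ∈ V ∩ V^{arc}_{L′}`. DERIVED definition by the printed case split. [claim: Joshi2024ATS3, status: disputed] -/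
@[claim "Joshi2024ATS3" "disputed"]
def xiAt (w : V) : ∀ k : PlaceKind, A.kind w = k → H1 w
  | .arc, h => A.qSchottky w h
  | .oddss, h => (A.tateAt w h).xiClass
  | .other, h => A.onePStarClass w (PlaceKind.ne_arc_of_eq_other h)

/-- **The global class `ξ_y = ξ_{hol(X/L′)_y} = (ξ_w)_{w ∈ V} ∈ H^1_e(arith(L′)_y, ℤ(1))`** ([J-III] (9.7.4.1)–(9.7.4.2), p.111
l.66–p.112 l.34), assembled from `xiAt` at the actual kind of each place. DERIVED. [claim: Joshi2024ATS3, status: disputed] -/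
@[claim "Joshi2024ATS3" "disputed"]
def xiGlobal : ∀ w : V, H1 w := fun w => A.xiAt w (A.kind w) rfl

/-- At `w ∈ V^{odd,ss}` the global class is the local class `ξ_w` of 9.6.2. [folklore] -/
theorem xiGlobal_of_oddss (w : V) (h : A.kind w = .oddss) : A.xiGlobal w = (A.tateAt w h).xiClass := by
  have key : ∀ (k : PlaceKind) (hk : A.kind w = k), A.xiAt w k hk = (A.tateAt w h).xiClass := fun k hk => by
    cases k with
    | arc => exact PlaceKind.noConfusion (hk.symm.trans h)
    | oddss => rfl
    | other => exact PlaceKind.noConfusion (hk.symm.trans h)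
  exact key _ rfl

/-- At an archimedean `w` the global class is the Schottky parameter class. [folklore] -/
theorem xiGlobal_of_arc (w : V) (h : A.kind w = .arc) : A.xiGlobal w = A.qSchottky w h := by
  have key : ∀ (k : PlaceKind) (hk : A.kind w = k), A.xiAt w k hk = A.qSchottky w h := fun k hk => by
    cases k with
    | arc => rfl
    | oddss => exact PlaceKind.noConfusion (hk.symm.trans h)
    | other => exact PlaceKind.noConfusion (hk.symm.trans h)
  exact key _ rfl

/-- At a nonarchimedean `w ∉ V^{odd,ss}` the global class is the class of `1 + p*_w`. [folklore] -/
theorem xiGlobal_of_other (w : V) (h : A.kind w = .other) :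
    A.xiGlobal w = A.onePStarClass w (PlaceKind.ne_arc_of_eq_other h) := by
  have key : ∀ (k : PlaceKind) (hk : A.kind w = k), A.xiAt w k hk = A.onePStarClass w (PlaceKind.ne_arc_of_eq_other h) :=
    fun k hk => by
    cases k with
    | arc => exact PlaceKind.noConfusion (hk.symm.trans h)
    | oddss => exact PlaceKind.noConfusion (hk.symm.trans h)
    | other => rfl
  exact key _ rfl

end ArithmeticoidDatum

/-! ## 6. (9.7.5), Proposition 9.7.5.1: collation of Galois cohomology classes in a standard arithmeticoid -/

/-- **Collation datum** (SIGNATURE for [J-III] 9.7.5, p.112 l.35–71): holomorphoids `y : Y` of `X/L′` (each with its arithmeticoid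
`arith(L′)_y` «given by Theorem 10.11.3.1»), the factors `H y w` of `H^1_e(arith(L′)_y, ℤ(1))` at the places `w : V`, the STANDARD
arithmeticoid `y₀` (§4.4), and at each `(y, w)` the SET of admissible identifications `H^1_e(arith(L′)_y)_w ≃ H^1_e(arith(L′)_{y₀})_w`:
«all (topological) isomorphisms … given by [Joshi, 2023a, Proposition 7.4.1]» (p.112 l.65–70), factorwise as in [ATS II½]
Prop. 7.5.1 («under all the isomorphisms (of topological groups) of each factor … provided by Proposition 7.4.1»). Which
isomorphisms these are is the datum (READING: print does not say whether "all topological-group isomorphisms" or "those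
induced by amphoricity"); bijections here. [claim: Joshi2024ATS3, status: disputed] -/
@[claim "Joshi2024ATS3" "disputed"]
structure ClassCollationDatum (Y V : Type*) (H : Y → V → Type*) where
  /-- the standard arithmeticoid `y₀` (§4.4) -/
  std : Y
  /-- the admissible factorwise isomorphisms `H^1_e(arith(L′)_y)_w ≃ H^1_e(arith(L′)_{y₀})_w` -/
  iso : ∀ (y : Y) (w : V), Set (H y w ≃ H std w)

namespace ClassCollationDatum

variable {Y V : Type*} {H : Y → V → Type*} (C : ClassCollationDatum Y V H) (Hol : Set Y) {A : Type*}
  (ξ : ∀ y : Y, A → ∀ w : V, H y w)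

/-- **`Ψ_Σ`, reading R1** ([J-III] Prop. 9.7.5.1, p.112 l.52–70): the subset of `∏_{a ∈ A} H^1_e(arith(L′)_{y₀}, ℤ(1))_a`
«consisting of the images of `ξ_{y,a}` (for each `a ∈ A` and for each `y ∈ Σ`) under all (topological) isomorphisms
`H^1_e(arith(L′)_y, ℤ(1)) ≃ H^1_e(arith(L′)_{y₀}, ℤ(1))`» — R1: ONE admissible factorwise isomorphism `φ = (φ_w)_w` moves the whole
`A`-tuple `(ξ_{y,a})_a` (as in [ATS II½] Prop. 7.5.1, where the image of a SUBSET under an isomorphism is taken). [claim: Joshi2024ATS3, status: disputed] -/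
@[claim "Joshi2024ATS3" "disputed"]
def collation : Set (A → ∀ w : V, H C.std w) :=
  {f | ∃ y ∈ Hol, ∃ φ : ∀ w : V, H y w ≃ H C.std w, (∀ w, φ w ∈ C.iso y w) ∧ ∀ a w, f a w = φ w (ξ y a w)}

/-- The `a`-th slot of `Ψ_Σ`: images of the classes `ξ_{y,a}`, `y ∈ Σ`, under all admissible factorwise isomorphisms. [claim: Joshi2024ATS3, status: disputed] -/
@[claim "Joshi2024ATS3" "disputed"]
def collationSlot (a : A) : Set (∀ w : V, H C.std w) :=
  {x | ∃ y ∈ Hol, ∃ φ : ∀ w : V, H y w ≃ H C.std w, (∀ w, φ w ∈ C.iso y w) ∧ ∀ w, x w = φ w (ξ y a w)}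

/-- **`Ψ_Σ`, reading R2**: the product over `a ∈ A` of the slots (independent `y` and `φ` per slot) — the widest reading of
«consisting of the images of `ξ_{y,a}` for each `a` and each `y`». [claim: Joshi2024ATS3, status: disputed] -/
@[claim "Joshi2024ATS3" "disputed"]
def collationIndep : Set (A → ∀ w : V, H C.std w) := {f | ∀ a, f a ∈ C.collationSlot Hol ξ a}

/-- R1 ⊆ R2. [folklore] -/
theorem collation_subset_collationIndep : C.collation Hol ξ ⊆ C.collationIndep Hol ξ := by
  rintro f ⟨y, hy, φ, hφ, hf⟩ a
  exact ⟨y, hy, φ, hφ, fun w => hf a w⟩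

/-- The classes of the standard arithmeticoid itself lie in `Ψ_Σ` whenever `y₀ ∈ Σ` and the identity is admissible at `y₀`.
[folklore] -/
theorem self_mem_collation (h0 : C.std ∈ Hol) (hid : ∀ w, Equiv.refl (H C.std w) ∈ C.iso C.std w) :
    ξ C.std ∈ C.collation Hol ξ :=
  ⟨C.std, h0, fun _ => Equiv.refl _, hid, fun _ _ => rfl⟩

/-- **Proposition 9.7.5.1 as printed** ([J-III] p.112 l.40–70; hypotheses §2.4/§3.1/§3.3, `A` a non-empty finite indexing set,
`Σ` a collection of holomorphoids, classes `{ξ_{y,a} : a ∈ A} ⊂ H^1_e(arith(L′)_y, ℤ(1))`, `arith(L′)_{y₀}` standard): «Then there is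
a set `Ψ_Σ ⊂ ∏_{a ∈ A} H^1_e(arith(L′)_{y₀}, ℤ(1))_a` consisting of the images of `ξ_{y,a}` … under all (topological) isomorphisms …»
(proof: «exactly as [Joshi, 2023a, Proposition 7.5.1]»). An existence-of-a-set statement (reading R1). [claim: Joshi2024ATS3, status: disputed] -/
@[claim "Joshi2024ATS3" "disputed"]
def Prop9751 : Prop :=
  ∃ Ψ : Set (A → ∀ w : V, H C.std w), ∀ f, f ∈ Ψ ↔
    ∃ y ∈ Hol, ∃ φ : ∀ w : V, H y w ≃ H C.std w, (∀ w, φ w ∈ C.iso y w) ∧ ∀ a w, f a w = φ w (ξ y a w)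

/-- Proposition 9.7.5.1 holds over the signature: `Ψ_Σ := collation` (DISCHARGED — the content is the definition). [folklore] -/
theorem prop9751_holds : C.Prop9751 Hol ξ := ⟨C.collation Hol ξ, fun _ => Iff.rfl⟩

end ClassCollationDatum

end Summit.ABC.IUTFork.Joshi.ATS3

end
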